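/-
Copyright (c) 2026. All rights reserved.
Released under Apache 2.0 license as described in the file LICENSE.
-/
import Literature.AlgebraicGeometry.ComplexMultiplication.HyperellipticJacobianLevelTwentyHodgeConjecture
import Literature.AlgebraicGeometry.ComplexMultiplication.HyperellipticJacobianTwoPowerHodgeRing
import HarnessLib

/-!
# The stably nondegenerate Jacobians `J_m = J(y² = x^m − 1)`: for `m ∈ {p, 2p, 2^k} ∪ {3, 4, 6, 8, 12, 24} ∪ {20}` every complex
# abelian variety isogenous to a product of the CM pieces of `J_m` has Hodge ring generated by divisors and satisfies the Hodge conjecture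

Layer `Literature/AlgebraicGeometry/ComplexMultiplication`, namespace `…ComplexMultiplication.HyperellipticJacobian`; the ASSEMBLY of the
series' Hodge-theoretic files — `HyperellipticJacobianTwoPowerHodgeRing` (Emory–Goodson: `m = 2^k`), `HyperellipticJacobianEllipticLevelsHodgeConjecture`
(F32: `m ∣ 24`), `HyperellipticJacobianPrimeLevelHodgeConjecture` (F33: `m = p, 2p`), `HyperellipticJacobianLevelTwentyHodgeConjecture` (F34:
`m = 20`) — into ONE statement on the `J_m`-family (one realisation `C_j ⊨ (ℚ(ζ_{e_j}); Ψ_j)` of the lower-half type at each divisor `e ≥ 3`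
of `m`, levels injective).  THEOREMS ONLY (no definition, no named fact, no `sorry`, no instance).

THE PRINT.  Gallese–Goodson–Lombardo [GalleseGoodsonLombardo2024] §1 (p. 5: Kubota — `J_p` simple nondegenerate; the simple factors of
`J_{p^k}` nondegenerate), §3 Thm. 3.0 (p. 12: the decomposition), §3.4–§3.5 (the exceptional levels `20, 24`; Lemma 15, Cor. 16); Emory–Goodson
[EmoryGoodson2026NondegeneracySatoTate] Thm. 1.2 ∕ Thm. 3.4 (`J(y² = x^{2^m} − 1)` is nondegenerate); Moonen–Zarhin [MoonenZarhin1999LowDim]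
Cor. (3.9) (products of CM elliptic curves); Gordon [Gordon1999HodgeAVSurvey] 7.4–7.6.1 (Hazama–Murty: stably nondegenerate ⟺ `rank Hg = rdim`)
and 10.10 (the Hodge conjecture for them).  THE LIST: by the tree's `cmFamilyRank_eq_one_add_totient_div_two_of_three_le`, `rank MT(J_m) =
1 + φ(m)/2` for every `m ≥ 3`; the reduced dimension `rdim J_m` (the sum of the dimensions of the pairwise non-isogenous simple factors
`X_d` (`d` odd), `Y_d` (`4 ∣ d`), `X_4`) equals `φ(m)/2` exactly for `m = p, 2p` (`rdim = (p−1)/2`), `m = 2^k` (`1 + 1 + 2 + ⋯ + 2^{k−3} =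
2^{k−2}`), `m ∈ {3, 4, 6, 8, 12, 24}` (`1, 1, 1, 2, 2, 4`) and `m = 20` (`1 + 2 + 1 = 4`), and exceeds it otherwise — so these are exactly the
`m` with `J_m` stably nondegenerate; this file proves the positive half (the negative half is typed in the tree for odd composite `m` and odd
prime powers: `exists_exceptional_of_minFac`, `not_isNondegenerateFamily_of_isPrimePow`; not for the even degenerate levels).

WHAT IS PROVED.  `hodge_of_isIsogenous_prod_of_twoPow` (the `2^k` case of the tree's Emory–Goodson file, restated on the divisor family);
**`hodge_of_isIsogenous_prod_of_stablyNondegenerateLevel`** — for `m` an odd prime, twice an odd prime, a power `2^k ≥ 4`, a divisor `≥ 3` of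
`24`, or `20`, and ANY `X ∼ ⨁_{k<N} C_{π k}`: `𝓑^q(X) ⊗ ℂ = 𝓓^q(X) ⊗ ℂ` for all `q` and `HodgeConjectureFor X`; the any-index, `J_m` and `J_mⁿ`
forms (`…'`, `hodge_biproduct_of_stablyNondegenerateLevel`, `hodge_of_isIsogenous_pow_biproduct_of_stablyNondegenerateLevel`).  A KNOWN case of
the Hodge conjecture; nothing here bears on the open cases.  «`J_m`» is the abstract biproduct (Thm. 3.0 read as hypothesis), as in F24–F34.
-/

noncomputable section

open CategoryTheory CategoryTheory.Limits NumberField Module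

namespace Literature.AlgebraicGeometry.ComplexMultiplication

open Literature.AlgebraicGeometry.Motives
open Literature.AlgebraicGeometry.Motives.AbelianVariety
open Literature.AlgebraicGeometry.Milne1999
open Literature.AlgebraicGeometry.HodgeTheory (complexBetti HodgeConjectureFor)
open Literature.AlgebraicGeometry.VanGeemen1994 (hodgeClassSpan)
open Literature.Barriers.HodgeConjecture (divisorClassesSpan)
open Literature.NumberTheory.ComplexMultiplication

namespace HyperellipticJacobian

open Literature.AlgebraicGeometry.Pohlmann1968 Literature.AlgebraicGeometry.Pohlmann1968.Cyclotomic

section Family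

variable {κ : Type} [Fintype κ] {lev : κ → ℕ} [∀ j, NeZero (lev j)] {F : κ → Type} [∀ j, Field (F j)]
  [∀ j, NumberField (F j)] [∀ j, IsCyclotomicExtension {lev j} ℚ (F j)] {Ψ : ∀ j, CMType (F j)} {C : κ → AbelianVariety ℂ}
  {ιC : ∀ j, 𝓞 (F j) →+* End (C j)} {θC : ∀ j, F j →+* Module.End ℂ (complexBetti (C j).X 1)}

/-- **`m = 2^k` (Emory–Goodson Thm. 1.2 ∕ 3.4, the tree's `HyperellipticJacobianTwoPower.hodge…_of_isIsogenous_prod`) on the divisor family**: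
the levels of the `J_{2^k}`-family are `4, 8, …, 2^k`, each once, so every `X ∼ ⨁_k C_{π k}` has `𝓑^q = 𝓓^q` for all `q` and satisfies the Hodge
conjecture. [cite: EmoryGoodson2026NondegeneracySatoTate, Thm. 1.2 and §3.2 Thm. 3.4] [cite: Gordon1999HodgeAVSurvey, 7.5 and 10.10] -/
theorem hodge_of_isIsogenous_prod_of_twoPow {k : ℕ} (hk : 2 ≤ k) (hlev : ∀ d, (∃ j, lev j = d) ↔ d ∣ 2 ^ k ∧ 3 ≤ d)
    (hinj : Function.Injective lev) (hΨ : ∀ j (σ : F j →+* ℂ), σ ∈ (Ψ j).1 ↔ 2 * (expOf (lev j) (F j) σ).val < lev j)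
    (hC : ∀ j, IsCMTypeRealisation (Ψ j) (C j) (ιC j) (θC j)) {N : ℕ} (π : Fin N → κ) {X : AbelianVariety ℂ}
    (hX : IsIsogenous X (⨁ fun i : Fin N => C (π i))) :
    (∀ q, hodgeClassSpan X.dim X.X q = divisorClassesSpan X.X X.dim q) ∧ HodgeConjectureFor X.dim X.X := by
  have hdvd : ∀ j, lev j ∣ 2 ^ k := fun j => ((hlev (lev j)).1 ⟨j, rfl⟩).1
  have hall : ∀ i, 2 ≤ i → i ≤ k → ∃ j, lev j = 2 ^ i := fun i hi hik =>
    (hlev (2 ^ i)).2 ⟨pow_dvd_pow 2 hik, le_trans (by norm_num) (Nat.pow_le_pow_right two_pos hi)⟩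
  have h4 : ∀ j, 4 ≤ lev j := fun j => by
    obtain ⟨hd, h3⟩ := (hlev (lev j)).1 ⟨j, rfl⟩
    obtain ⟨i, -, hi⟩ := (Nat.dvd_prime_pow Nat.prime_two).1 hd
    rw [hi] at h3 ⊢
    have hi2 : 2 ≤ i := by
      by_contra hlt
      have : 2 ^ i ≤ 2 ^ 1 := Nat.pow_le_pow_right two_pos (by omega)
      omega
    exact le_trans (by norm_num) (Nat.pow_le_pow_right two_pos hi2)
  exact ⟨fun q => HyperellipticJacobianTwoPower.hodgeClassSpan_eq_divisorClassesSpan_of_isIsogenous_prod hk hdvd hall hinj h4 Ψ hΨ hC π hX q,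
    HyperellipticJacobianTwoPower.hodgeConjectureFor_of_isIsogenous_prod hk hdvd hall hinj h4 Ψ hΨ hC π hX⟩

/-- **THE STABLY NONDEGENERATE `J_m`: for `m` an odd prime, twice an odd prime, a power of two `≥ 4`, a divisor `≥ 3` of `24`, or `20`, EVERY
complex abelian variety isogenous to a product `⨁_{k<N} C_{π k}` of members of the `J_m`-family — all `∏_j C_j^{n_j}`, in particular `J_m` and
its powers — has `𝓑^q ⊗ ℂ = 𝓓^q ⊗ ℂ` for every `q` and satisfies the Hodge conjecture** (assembly of the four files; `rank MT(J_m) = 1 + φ(m)/2 =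
rdim J_m + 1` exactly at these `m`).  A KNOWN case; nothing here bears on the open cases. [cite: GalleseGoodsonLombardo2024, §1 (p. 5), §3 Thm. 3.0, §3.4 and §3.5 Lemma 15 with Cor. 16]
[cite: EmoryGoodson2026NondegeneracySatoTate, Thm. 1.2] [cite: MoonenZarhin1999LowDim, Cor. (3.9)] [cite: Kubota1965, §4 Thm. 2 and Lemma 2]
[cite: Gordon1999HodgeAVSurvey, 7.4, 7.5, 7.6.1 and 10.10] -/
theorem hodge_of_isIsogenous_prod_of_stablyNondegenerateLevel {m : ℕ}
    (hm : (m.Prime ∧ m ≠ 2) ∨ (∃ p, p.Prime ∧ p ≠ 2 ∧ m = 2 * p) ∨ (∃ k, 2 ≤ k ∧ m = 2 ^ k) ∨ (3 ≤ m ∧ m ∣ 24) ∨ m = 20)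
    (hlev : ∀ d, (∃ j, lev j = d) ↔ d ∣ m ∧ 3 ≤ d) (hinj : Function.Injective lev)
    (hΨ : ∀ j (σ : F j →+* ℂ), σ ∈ (Ψ j).1 ↔ 2 * (expOf (lev j) (F j) σ).val < lev j)
    (hC : ∀ j, IsCMTypeRealisation (Ψ j) (C j) (ιC j) (θC j)) {N : ℕ} (π : Fin N → κ) {X : AbelianVariety ℂ}
    (hX : IsIsogenous X (⨁ fun i : Fin N => C (π i))) :
    (∀ q, hodgeClassSpan X.dim X.X q = divisorClassesSpan X.X X.dim q) ∧ HodgeConjectureFor X.dim X.X := by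
  rcases hm with ⟨hp, hp2⟩ | ⟨p, hp, hp2, rfl⟩ | ⟨k, hk, rfl⟩ | ⟨hm3, hm24⟩ | rfl
  · exact hodge_of_isIsogenous_prod_of_prime_or_twice_prime hp hp2 (Or.inl rfl) hlev hinj hΨ hC π hX
  · exact hodge_of_isIsogenous_prod_of_prime_or_twice_prime hp hp2 (Or.inr rfl) hlev hinj hΨ hC π hX
  · exact hodge_of_isIsogenous_prod_of_twoPow hk hlev hinj hΨ hC π hX
  · exact hodge_of_isIsogenous_prod_of_dvd_twentyFour hm3 hm24 hlev hinj hΨ hC π hX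
  · exact hodge_of_isIsogenous_prod_twenty hlev hinj hΨ hC π hX

/-- **The same for products indexed by any finite type** (`X ∼ ⨁_{i : ι} C_{f i}`). [cite: GalleseGoodsonLombardo2024, §1 and §3 Thm. 3.0]
[cite: Gordon1999HodgeAVSurvey, 7.5 and 10.10] -/
theorem hodge_of_isIsogenous_prod_of_stablyNondegenerateLevel' {m : ℕ}
    (hm : (m.Prime ∧ m ≠ 2) ∨ (∃ p, p.Prime ∧ p ≠ 2 ∧ m = 2 * p) ∨ (∃ k, 2 ≤ k ∧ m = 2 ^ k) ∨ (3 ≤ m ∧ m ∣ 24) ∨ m = 20)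
    (hlev : ∀ d, (∃ j, lev j = d) ↔ d ∣ m ∧ 3 ≤ d) (hinj : Function.Injective lev)
    (hΨ : ∀ j (σ : F j →+* ℂ), σ ∈ (Ψ j).1 ↔ 2 * (expOf (lev j) (F j) σ).val < lev j)
    (hC : ∀ j, IsCMTypeRealisation (Ψ j) (C j) (ιC j) (θC j)) {ι : Type} [Fintype ι] [DecidableEq ι] (f : ι → κ)
    {X : AbelianVariety ℂ} (hX : IsIsogenous X (⨁ fun i : ι => C (f i))) :
    (∀ q, hodgeClassSpan X.dim X.X q = divisorClassesSpan X.X X.dim q) ∧ HodgeConjectureFor X.dim X.X :=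
  hodge_of_isIsogenous_prod_of_stablyNondegenerateLevel hm hlev hinj hΨ hC (fun k => f ((Fintype.equivFin ι).symm k))
    (hX.trans (isIsogenous_biproduct_reindex (Fintype.equivFin ι).symm fun i => C (f i)).symm')

/-- **THE HODGE CONJECTURE FOR `J_m` ITSELF, `m` in the stably nondegenerate list** (`𝓑^q = 𝓓^q` for all `q`, and `HodgeConjectureFor`, on the
biproduct `⨁_j C_j` of the Thm.-3.0 decomposition). [cite: GalleseGoodsonLombardo2024, §1 (p. 5) and §3 Thm. 3.0] [cite: Gordon1999HodgeAVSurvey, 7.5 and 10.10] -/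
theorem hodge_biproduct_of_stablyNondegenerateLevel {m : ℕ}
    (hm : (m.Prime ∧ m ≠ 2) ∨ (∃ p, p.Prime ∧ p ≠ 2 ∧ m = 2 * p) ∨ (∃ k, 2 ≤ k ∧ m = 2 ^ k) ∨ (3 ≤ m ∧ m ∣ 24) ∨ m = 20)
    (hlev : ∀ d, (∃ j, lev j = d) ↔ d ∣ m ∧ 3 ≤ d) (hinj : Function.Injective lev)
    (hΨ : ∀ j (σ : F j →+* ℂ), σ ∈ (Ψ j).1 ↔ 2 * (expOf (lev j) (F j) σ).val < lev j)
    (hC : ∀ j, IsCMTypeRealisation (Ψ j) (C j) (ιC j) (θC j)) :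
    (∀ q, hodgeClassSpan (⨁ C).dim (⨁ C).X q = divisorClassesSpan (⨁ C).X (⨁ C).dim q) ∧ HodgeConjectureFor (⨁ C).dim (⨁ C).X := by
  classical
  exact hodge_of_isIsogenous_prod_of_stablyNondegenerateLevel' hm hlev hinj hΨ hC id (IsIsogenous.refl _)

/-- **THE HODGE CONJECTURE FOR ALL POWERS `J_mⁿ`, `m` in the stably nondegenerate list** (and everything isogenous to one): the Hodge ring of
`J_mⁿ` is generated by divisor classes for every `n`. [cite: GalleseGoodsonLombardo2024, §1 (p. 5) and §3 Thm. 3.0] [cite: Gordon1999HodgeAVSurvey, 7.5, 7.6.1 and 10.10] -/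
theorem hodge_of_isIsogenous_pow_biproduct_of_stablyNondegenerateLevel {m : ℕ}
    (hm : (m.Prime ∧ m ≠ 2) ∨ (∃ p, p.Prime ∧ p ≠ 2 ∧ m = 2 * p) ∨ (∃ k, 2 ≤ k ∧ m = 2 ^ k) ∨ (3 ≤ m ∧ m ∣ 24) ∨ m = 20)
    (hlev : ∀ d, (∃ j, lev j = d) ↔ d ∣ m ∧ 3 ≤ d) (hinj : Function.Injective lev)
    (hΨ : ∀ j (σ : F j →+* ℂ), σ ∈ (Ψ j).1 ↔ 2 * (expOf (lev j) (F j) σ).val < lev j)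
    (hC : ∀ j, IsCMTypeRealisation (Ψ j) (C j) (ιC j) (θC j)) (n : ℕ) {X : AbelianVariety ℂ}
    (hX : IsIsogenous X (⨁ fun _ : Fin n => ⨁ C)) :
    (∀ q, hodgeClassSpan X.dim X.X q = divisorClassesSpan X.X X.dim q) ∧ HodgeConjectureFor X.dim X.X := by
  classical
  have h1 : IsIsogenous (⨁ fun _ : Fin n => ⨁ C) (⨁ fun q : (_ : Fin n) × κ => C q.2) :=
    isIsogenous_biproduct_biproduct_sigma fun (_ : Fin n) (j : κ) => C j
  exact hodge_of_isIsogenous_prod_of_stablyNondegenerateLevel' hm hlev hinj hΨ hC (fun q : (_ : Fin n) × κ => q.2) (hX.trans h1)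

end Family

end HyperellipticJacobian

end Literature.AlgebraicGeometry.ComplexMultiplication

end
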